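import Summits.QuantumFields.YangMills.Theses.ContractibleFibre
import Literature.MathematicalPhysics.QuantumLattice.GaugeGroupsProofs

/-!
# Disproof of `FibreAnchor` — findings (crux stmt-QuantumFields-16243, route `ContractibleFibre`)

Standing disprover's work file (cdisprove, cycle 1, 2026-08-17). Everything here is
kernel-checked except the explicitly `sorry`-marked near-misses in § Near-misses.

## Findings, indexed

* **(V) The let-tower is definitional.** The crux `FibreAnchor` (its `Tube / St / Cfg / ν / sh /
  ins / pl / act / wgt / Ex / σ / Loc` inline vocabulary) is BY `Iff.rfl` the statement
  `∀ G …, ∀ r M, ∃ β₀ m₀ > 0, ∀ β ≥ β₀, ∀ w, ∃ C Lmin, TubeWith G (fun n L => 2 * n < L) r M β m₀ C w Lmin`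
  over the NAMED definitions of § Vocabulary (`fibreAnchor_iff`). Provers: import nothing from
  here (work file), but copy the vocabulary block verbatim — every lemma below is then about
  named, unfoldable objects instead of a 40-line `let` chain.
* **(N) No junk.** `G` is Hausdorff and second countable through `r` (`t2Space_of_rep`,
  `secondCountable_of_rep`); the weight is continuous, positive, bounded, measurable and
  integrable, the partition function is `> 0` (`Z_pos`), so `Ex` is a genuine normalised
  positive functional; the crux is neither vacuous nor trivially true.
* **(D) Dangling links are exactly Haar.** At `M = 0` every direction-`2` link lies in no
  plaquette (`ins_zero_eq_zero`), the action is invariant under left-multiplying all of them by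
  any `g` (`act_mulDir`), that map preserves product Haar (`measurePreserving_mulDir`), hence
  `∫ F∘mulDir_g · wgt = ∫ F · wgt` (`integral_comp_mulDir`) and the probability that one such
  link lies in an open `O ∋ 1` is pinned in `[1/k, 1/2]` UNIFORMLY in `L`, `β`, position
  (`Ex_obs_mem`; `k` = number of translates of `O` covering `G`). This is the cheapest
  non-degenerate observable of the tube and the engine of all load-bearing lemmas below.
* **(A1) Load-bearing: the guard `2 * n < L`.** Weakened to `n < L` (all separations on the time
  circle) the clause is FALSE at `M = 0` for every `(G, r)`, every `β`, every `m₀ > 0`, `C`,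
  `Lmin` (`tubeWith_fullCircle_false`: the shift `n = L-1` wraps the circle). Verbatim variant
  `FibreAnchorFullCircle`, unconditional `not_fibreAnchorFullCircle` (instance `SU(2)`).
* **(A2) Load-bearing: the order `∀ w ∃ C`.** One constant for all slab widths (floor still
  `w`-dependent) is FALSE (`tubeWith_uniformW_false`; variant `FibreAnchorUniformW`,
  `not_fibreAnchorUniformW`): overlapping slabs at `n = w`.
* **(A3) Load-bearing: `|F U| ≤ 1`.** Without the bound (constant `C` independent of the
  observables) FALSE by scaling (`tubeU_false`; variant `FibreAnchorUnbounded`,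
  `not_fibreAnchorUnbounded`).
* **(A4) NOT load-bearing alone (information for the prover).** Dropping the volume floor `Lmin`
  ALONE does not falsify (for fixed `β` the torelon rate `σ₂(β)·L → ∞` with `L`, finitely many
  slow `L`, absorbed in `C(β)`); making `C` β-uniform ALONE does not falsify (spectral bound gives
  `C = O(e^{m₀(w+1)})`). Dropping BOTH (β-uniform floor and constant) IS false by torelons —
  § Near-misses, `tubeWith_uniformFloor_false` (sorried: needs the 2-d character expansion).
* **(P) Physics attacks that found nothing** (details in the crux's STRATEGY-CENSUS.md §Negation,
  confirmed independently here): torelon accumulation (killed by `Lmin(β)`), KK pairs below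
  threshold (binding `→ 0⁺`, threshold β-independent in lattice units), Pirogov–Sinai centre
  phases (faithful `r` ⇒ unique maximiser of `Re χ_r`, extensive cost), extended observables
  (α-mixing ≤ ρ-mixing/4 and ρ tensorises: the transfer-matrix gap controls ALL bounded slab
  observables uniformly in `L`), `U(1)` at fixed `M` (gapped KK photons: consistent), gauge-variant
  observables (gauge averaging factorises over disjoint slabs for `n > w + 1`).
  **Why it resists:** the crux is the weak-coupling mass gap of a 2-d lattice gauge theory with
  massive adjoint KK matter at flavour-'t Hooft coupling `2/β → 0` — believed true, no expansion
  in print; every cheap failure mode is guarded by `Lmin(β)`, `2n < L`, `C(β, w)`, `|F| ≤ 1`.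

## Landed (importable extracts, `--supports stmt-QuantumFields-16243`)
* `Summits/QuantumFields/YangMills/Theorems/FibreAnchor/Negative/TubeVocabulary.lean` (p160103):
  vocabulary (V), no junk (N), dangling-link symmetry (D), `obs`.
* `…/Negative/DanglingLink.lean` (p160365): `Ex_obs_mem`, `variance_floor`, `exists_variance_floor`.
* `…/Negative/LoadBearingClauses.lean` (part 3/3, proposed after the two above): (A1)–(A3)
  unconditional — `fibreAnchor_false_without_halfTimeGuard`, `fibreAnchor_false_with_widthUniformConstant`,
  `fibreAnchor_false_without_observableBound`.

## Targets
None yet (payload `targets = []`; the lead PICKED line `trace-vdr` on 2026-08-17, stubs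
`stub_vacuumDominanceRate` (S1) / `stub_traceFormulaClustering` (S2a) / `stub_tracePackaging` (S2b)
— they become targets on re-arm). Pre-analysis, no kill expected: S1 is consistent with the
torelon sector (`Tr T²/λ₀² ≳ (β/L)^{rank/2}` from flux sectors is absorbed by `C(β)` AND capped
by the floor `β/L ≲ 1/m₀`) and with the dilute-gas entropy (`log(Z/λ₀^{j+1}) = O(L)·e^{−Δ(j+1)}`,
linear in `L` is the right shape); S2b's positivity needs `0 ≤ β` (reshape r1 has it) and the
conditional independence of time-like layers given the slices (true for the inline weight). S2a (`stub_traceFormulaClustering`, absolute constant `64·e^{m₀(w+1)}`, rate `m₀/2`): the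
two-state reversible chain `K = [[1+ε,1−ε],[1−ε,1+ε]]` (`μ` uniform on two points, `Z_j = 1 + ε^{j+1}`)
satisfies the hypotheses with `lam = 1`, `E = e^{(m₀−m₁)N}` iff its true gap `m₁ = −log ε` is
`≳ 3m₀/4` (threshold `N ≥ (4/m₀) log(2+E) + 4(w+1)` ⇒ `4(1 − m₁/m₀) ≤ 1 + O(1/N)`), so the
claimed rate `m₀/2` has slack `m₀/4` and single-mode chains cannot violate it; conversely ANY
rate `> 3m₀/4` in S2a's conclusion IS refuted by such a chain with `N` large (tightness of the
threshold/rate pair; a `native_decide`-free Lean certificate would need the tree's cyclic-kernel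
trace formula `hasSum_pow_integral_cyclic` on a two-point space). The lead hand-checked the
constant (`≤ 19 e^{m₀ w}`).
-/

set_option autoImplicit false

noncomputable section

namespace Summit.QuantumFields.YangMills.Cruxes.FibreAnchor.Disproof

open MeasureTheory
open Literature.MathematicalPhysics.QuantumFieldTheory
open Summit.QuantumFields.YangMills.Theses.ContractibleFibre

/-! ## Vocabulary — the crux's inline `let`s as named definitions (definitionally equal) -/

section Vocabulary

variable (G : Type) [Group G] [TopologicalSpace G] [IsTopologicalGroup G] [CompactSpace G]
  [MeasurableSpace G] [BorelSpace G]

/-- Sites of the free tube `(ℤ/L)² × Fin (M+1)²` (time, space, two fibre coordinates). -/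
abbrev St (L M : ℕ) : Type := ZMod L × ZMod L × Fin (M + 1) × Fin (M + 1)

/-- Link configurations of the free tube. -/
abbrev Cfg (L M : ℕ) : Type := St L M × Fin 4 → G

/-- Product Haar probability measure on the links (the crux's `ν`). -/
def haarPi (L M : ℕ) [NeZero L] : Measure (Cfg G L M) :=
  Measure.pi fun _ => haarProbability G

/-- The crux's `sh` (one step in direction `μ`). -/
def sh (L M : ℕ) : St L M → Fin 4 → St L M := fun x μ =>
  ![(x.1 + 1, x.2.1, x.2.2.1, x.2.2.2), (x.1, x.2.1 + 1, x.2.2.1, x.2.2.2),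
    (x.1, x.2.1, x.2.2.1 + 1, x.2.2.2), (x.1, x.2.1, x.2.2.1, x.2.2.2 + 1)] μ

/-- The crux's `ins` (plaquette inside the tube: free fibre faces). -/
def ins (L M : ℕ) : St L M → Fin 4 → Fin 4 → ℝ := fun x μ κ =>
  if ((μ = 2 ∨ κ = 2) → (x.2.2.1 : ℕ) < M) ∧ ((μ = 3 ∨ κ = 3) → (x.2.2.2 : ℕ) < M) then 1 else 0

/-- The crux's `pl` (plaquette holonomy). -/
def pl (L M : ℕ) : Cfg G L M → St L M → Fin 4 → Fin 4 → G := fun U x μ κ =>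
  U (x, μ) * U (sh L M x μ, κ) * (U (sh L M x κ, μ))⁻¹ * (U (x, κ))⁻¹

/-- The crux's `act` (Wilson action of the free tube at coupling `β`). -/
def act (r : LatticeRep G) (L M : ℕ) [NeZero L] (β : ℝ) : Cfg G L M → ℝ := fun U =>
  β * ∑ x : St L M, ∑ q : {q : Fin 4 × Fin 4 // q.1 < q.2},
    ins L M x q.1.1 q.1.2 * (r.ρ (pl G L M U x q.1.1 q.1.2)).trace.re

/-- The crux's `wgt`. -/
def wgt (r : LatticeRep G) (L M : ℕ) [NeZero L] (β : ℝ) : Cfg G L M → ℝ := fun U =>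
  Real.exp (act G r L M β U)

/-- The crux's `Ex` (ratio-of-integrals expectation). -/
def Ex (r : LatticeRep G) (L M : ℕ) [NeZero L] (β : ℝ) : (Cfg G L M → ℝ) → ℝ := fun F =>
  (∫ U, F U * wgt G r L M β U ∂(haarPi G L M)) / (∫ U, wgt G r L M β U ∂(haarPi G L M))

/-- The crux's `σ` (time shift by `n`). -/
def shiftT (L M : ℕ) : ℕ → Cfg G L M → Cfg G L M := fun n U p => U ((p.1.1 + n, p.1.2), p.2)

/-- The crux's `Loc` (measurable, bounded by `1`, `[c, c+w]`-time-slab local). -/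
def Loc (L M : ℕ) (w : ℕ) (c : ZMod L) : (Cfg G L M → ℝ) → Prop := fun F =>
  Measurable F ∧ (∀ U, |F U| ≤ 1) ∧
    ∀ U U', (∀ p : St L M × Fin 4, (p.1.1 - c).val ≤ w → U p = U' p) → F U = F U'

/-- `Loc` WITHOUT the bound `|F U| ≤ 1` (for the load-bearing analysis (A3)). -/
def LocU (L M : ℕ) (w : ℕ) (c : ZMod L) : (Cfg G L M → ℝ) → Prop := fun F =>
  Measurable F ∧
    ∀ U U', (∀ p : St L M × Fin 4, (p.1.1 - c).val ≤ w → U p = U' p) → F U = F U'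

/-- The crux's clustering clause `Tube M β m C w Lmin`, with the admissible time separations
`n` given by a general guard `guard n L` (the crux: `2 * n < L`). -/
def TubeWith (guard : ℕ → ℕ → Prop) (r : LatticeRep G) (M : ℕ) (β m C : ℝ) (w Lmin : ℕ) :
    Prop :=
  ∀ (L : ℕ) [NeZero L], Lmin ≤ L → ∀ c : ZMod L, ∀ F₁ F₂ : Cfg G L M → ℝ,
    Loc G L M w c F₁ → Loc G L M w c F₂ → ∀ n : ℕ, guard n L →
      |Ex G r L M β (fun U => F₁ U * F₂ (shiftT G L M n U)) -
          Ex G r L M β F₁ * Ex G r L M β (fun U => F₂ (shiftT G L M n U))| ≤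
        C * Real.exp (-(m * n))

/-- The clustering clause with UNBOUNDED observables (`LocU`), guard `2 * n < L`. -/
def TubeU (r : LatticeRep G) (M : ℕ) (β m C : ℝ) (w Lmin : ℕ) : Prop :=
  ∀ (L : ℕ) [NeZero L], Lmin ≤ L → ∀ c : ZMod L, ∀ F₁ F₂ : Cfg G L M → ℝ,
    LocU G L M w c F₁ → LocU G L M w c F₂ → ∀ n : ℕ, 2 * n < L →
      |Ex G r L M β (fun U => F₁ U * F₂ (shiftT G L M n U)) -
          Ex G r L M β F₁ * Ex G r L M β (fun U => F₂ (shiftT G L M n U))| ≤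
        C * Real.exp (-(m * n))

end Vocabulary

/-- **(V)** The crux, verbatim, is the `2 * n < L` instance of `TubeWith` — by `Iff.rfl`. -/
theorem fibreAnchor_iff :
    FibreAnchor ↔
      ∀ (G : Type) [Group G] [TopologicalSpace G] [IsTopologicalGroup G] [CompactSpace G],
        IsCompactSimpleLieGroup G → letI : MeasurableSpace G := borel G;
        haveI : BorelSpace G := ⟨rfl⟩;
        ∀ r : LatticeRep G, ∀ M : ℕ, ∃ β₀ m₀ : ℝ, 0 < m₀ ∧ ∀ β : ℝ, β₀ ≤ β → ∀ w : ℕ,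
          ∃ C : ℝ, ∃ Lmin : ℕ, TubeWith G (fun n L => 2 * n < L) r M β m₀ C w Lmin :=
  Iff.rfl

/-! ## (N) No junk: topology and measure theory of the vocabulary -/

section Rep

variable {G : Type} [Group G] [TopologicalSpace G] [CompactSpace G]

/-- A faithful continuous matrix representation makes `G` Hausdorff. -/
theorem t2Space_of_rep (r : LatticeRep G) : T2Space G :=
  (r.continuous.isClosedEmbedding r.injective).isEmbedding.t2Space

/-- A faithful continuous matrix representation makes the compact group second countable. -/
theorem secondCountable_of_rep (r : LatticeRep G) : SecondCountableTopology G :=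
  (r.continuous.isClosedEmbedding r.injective).isEmbedding.secondCountableTopology

/-- A compact simple Lie group has an element `≠ 1` (it is non-abelian). -/
theorem exists_ne_one_of_isCompactSimpleLieGroup (hG : IsCompactSimpleLieGroup G) :
    ∃ a : G, a ≠ 1 := by
  obtain ⟨a, b, hab⟩ := hG.1.2.1
  refine ⟨a, fun ha => hab ?_⟩
  rw [ha, one_mul, mul_one]

end Rep

section GroupOnly

variable {G : Type} [Group G]

/-- Left-multiply every direction-`2` link by `g` (a symmetry of the `M = 0` tube, where all
direction-`2` links are dangling). -/
def mulDir (g : G) (L M : ℕ) : Cfg G L M → Cfg G L M := fun U p =>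
  if p.2 = 2 then g * U p else U p

theorem mulDir_apply_of_ne {g : G} {L M : ℕ} (U : Cfg G L M) {p : St L M × Fin 4}
    (hp : p.2 ≠ 2) : mulDir g L M U p = U p := by
  simp [mulDir, hp]

theorem mulDir_apply_two {g : G} {L M : ℕ} (U : Cfg G L M) (x : St L M) :
    mulDir g L M U (x, 2) = g * U (x, 2) := by
  simp [mulDir]

/-- **(D)** At fibre width `M = 0` every plaquette touching direction `2` or `3` is switched off:
all direction-`2`/`3` links are dangling. -/
theorem ins_zero_eq_zero {L : ℕ} (x : St L 0) {μ κ : Fin 4}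
    (h : μ = 2 ∨ κ = 2 ∨ μ = 3 ∨ κ = 3) : ins L 0 x μ κ = 0 := by
  unfold ins
  rw [if_neg]
  rintro ⟨h2, h3⟩
  rcases h with h | h | h | h
  · exact absurd (h2 (Or.inl h)) (Nat.not_lt_zero _)
  · exact absurd (h2 (Or.inr h)) (Nat.not_lt_zero _)
  · exact absurd (h3 (Or.inl h)) (Nat.not_lt_zero _)
  · exact absurd (h3 (Or.inr h)) (Nat.not_lt_zero _)

/-- Plaquettes avoiding direction `2` do not see the direction-`2` links. -/
theorem pl_mulDir_of_ne (g : G) {L M : ℕ} (U : Cfg G L M) (x : St L M) {μ κ : Fin 4}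
    (hμ : μ ≠ 2) (hκ : κ ≠ 2) : pl G L M (mulDir g L M U) x μ κ = pl G L M U x μ κ := by
  unfold pl
  rw [mulDir_apply_of_ne U (p := (x, μ)) hμ, mulDir_apply_of_ne U (p := (sh L M x μ, κ)) hκ,
    mulDir_apply_of_ne U (p := (sh L M x κ, μ)) hμ, mulDir_apply_of_ne U (p := (x, κ)) hκ]

variable [TopologicalSpace G]

/-- **(D)** The `M = 0` action is blind to the direction-`2` links. -/
theorem act_mulDir (r : LatticeRep G) (g : G) (L : ℕ) [NeZero L] (β : ℝ) (U : Cfg G L 0) :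
    act G r L 0 β (mulDir g L 0 U) = act G r L 0 β U := by
  unfold act
  congr 1
  refine Finset.sum_congr rfl fun x _ => Finset.sum_congr rfl fun q _ => ?_
  by_cases h : q.1.1 = 2 ∨ q.1.2 = 2 ∨ q.1.1 = 3 ∨ q.1.2 = 3
  · rw [ins_zero_eq_zero x h, zero_mul, zero_mul]
  · push Not at h
    rw [pl_mulDir_of_ne g U x h.1 h.2.1]

theorem wgt_mulDir (r : LatticeRep G) (g : G) (L : ℕ) [NeZero L] (β : ℝ) (U : Cfg G L 0) :
    wgt G r L 0 β (mulDir g L 0 U) = wgt G r L 0 β U := by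
  unfold wgt
  rw [act_mulDir]

/-- The weight is strictly positive. -/
theorem wgt_pos (r : LatticeRep G) (L M : ℕ) [NeZero L] (β : ℝ) (U : Cfg G L M) :
    0 < wgt G r L M β U :=
  Real.exp_pos _

end GroupOnly

section Core

variable {G : Type} [Group G] [TopologicalSpace G] [IsTopologicalGroup G] [CompactSpace G]
  [MeasurableSpace G] [BorelSpace G]

instance haarPi.instIsProbabilityMeasure (L M : ℕ) [NeZero L] :
    IsProbabilityMeasure (haarPi G L M) := by
  unfold haarPi; infer_instance

theorem isMulLeftInvariant_haarProbability :
    Measure.IsMulLeftInvariant (haarProbability G) := by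
  unfold haarProbability; infer_instance

omit [CompactSpace G] [MeasurableSpace G] [BorelSpace G] in
/-- The plaquette holonomy is continuous in the configuration. -/
theorem continuous_pl (L M : ℕ) (x : St L M) (μ κ : Fin 4) :
    Continuous fun U : Cfg G L M => pl G L M U x μ κ := by
  unfold pl
  exact (((continuous_apply (x, μ)).mul (continuous_apply (sh L M x μ, κ))).mul
    ((continuous_apply (sh L M x κ, μ)).inv)).mul ((continuous_apply (x, κ)).inv)

omit [CompactSpace G] [MeasurableSpace G] [BorelSpace G] in
/-- The free-tube action is continuous. -/
theorem continuous_act (r : LatticeRep G) (L M : ℕ) [NeZero L] (β : ℝ) :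
    Continuous (act G r L M β) := by
  unfold act
  refine continuous_const.mul (continuous_finsetSum _ fun x _ => ?_)
  refine continuous_finsetSum _ fun q _ => continuous_const.mul ?_
  exact Complex.continuous_re.comp ((r.continuous.comp (continuous_pl L M x _ _)).matrix_trace)

omit [CompactSpace G] [MeasurableSpace G] [BorelSpace G] in
/-- The weight is continuous. -/
theorem continuous_wgt (r : LatticeRep G) (L M : ℕ) [NeZero L] (β : ℝ) :
    Continuous (wgt G r L M β) :=
  Real.continuous_exp.comp (continuous_act r L M β)

/-- The weight is measurable (second countability of `G` through `r`). -/
theorem measurable_wgt (r : LatticeRep G) (L M : ℕ) [NeZero L] (β : ℝ) :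
    Measurable (wgt G r L M β) := by
  haveI := secondCountable_of_rep r
  exact (continuous_wgt r L M β).measurable

omit [MeasurableSpace G] [BorelSpace G] in
/-- The weight is bounded (continuous on a compact configuration space). -/
theorem exists_wgt_le (r : LatticeRep G) (L M : ℕ) [NeZero L] (β : ℝ) :
    ∃ B : ℝ, ∀ U, wgt G r L M β U ≤ B := by
  obtain ⟨U₀, -, hU₀⟩ :=
    isCompact_univ.exists_isMaxOn Set.univ_nonempty (continuous_wgt r L M β).continuousOn
  exact ⟨wgt G r L M β U₀, fun U => hU₀ (Set.mem_univ U)⟩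

/-- The weight is integrable against product Haar. -/
theorem integrable_wgt (r : LatticeRep G) (L M : ℕ) [NeZero L] (β : ℝ) :
    Integrable (wgt G r L M β) (haarPi G L M) := by
  obtain ⟨B, hB⟩ := exists_wgt_le r L M β
  refine Integrable.of_bound (measurable_wgt r L M β).aestronglyMeasurable B
    (ae_of_all _ fun U => ?_)
  rw [Real.norm_of_nonneg (wgt_pos r L M β U).le]
  exact hB U

/-- `F · wgt` is integrable for a measurable `F` bounded by `B`. -/
theorem integrable_mul_wgt (r : LatticeRep G) (L M : ℕ) [NeZero L] (β : ℝ)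
    {F : Cfg G L M → ℝ} (hF : Measurable F) {B : ℝ} (hFb : ∀ U, |F U| ≤ B) :
    Integrable (fun U => F U * wgt G r L M β U) (haarPi G L M) :=
  (integrable_wgt r L M β).bdd_mul hF.aestronglyMeasurable
    (ae_of_all _ fun U => by simpa [Real.norm_eq_abs] using hFb U)

/-- **(N)** The partition function is strictly positive. -/
theorem Z_pos (r : LatticeRep G) (L M : ℕ) [NeZero L] (β : ℝ) :
    0 < ∫ U, wgt G r L M β U ∂(haarPi G L M) :=
  integral_exp_pos (integrable_wgt r L M β)

/-- `Ex` in terms of the un-normalised functional `J(F) = ∫ F · wgt`. -/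
theorem Ex_eq (r : LatticeRep G) (L M : ℕ) [NeZero L] (β : ℝ) (F : Cfg G L M → ℝ) :
    Ex G r L M β F =
      (∫ U, F U * wgt G r L M β U ∂(haarPi G L M)) / (∫ U, wgt G r L M β U ∂(haarPi G L M)) :=
  rfl

/-- `Ex` is homogeneous. -/
theorem Ex_const_mul (r : LatticeRep G) (L M : ℕ) [NeZero L] (β : ℝ) (s : ℝ)
    (F : Cfg G L M → ℝ) : Ex G r L M β (fun U => s * F U) = s * Ex G r L M β F := by
  rw [Ex_eq, Ex_eq, ← mul_div_assoc, ← integral_const_mul]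
  congr 1
  refine integral_congr_ae (ae_of_all _ fun U => ?_)
  simp only [mul_assoc]

omit [CompactSpace G] in
theorem measurable_mulDir (g : G) (L M : ℕ) : Measurable (mulDir g L M) := by
  refine measurable_pi_lambda _ fun p => ?_
  by_cases hp : p.2 = 2
  · simp only [mulDir, hp, if_true]
    exact (measurable_const_mul g).comp (measurable_pi_apply p)
  · simp only [mulDir, hp, if_false]
    exact measurable_pi_apply p

/-- **(D)** `mulDir g` preserves product Haar (left invariance of Haar, factorwise). -/
theorem measurePreserving_mulDir (g : G) (L M : ℕ) [NeZero L] :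
    MeasurePreserving (mulDir g L M) (haarPi G L M) (haarPi G L M) := by
  haveI := isMulLeftInvariant_haarProbability (G := G)
  have hf : ∀ p : St L M × Fin 4, MeasurePreserving
      ((fun (p : St L M × Fin 4) (x : G) => if p.2 = 2 then g * x else x) p)
      (haarProbability G) (haarProbability G) := by
    intro p
    by_cases hp : p.2 = 2
    · simp only [hp, if_true]
      exact measurePreserving_mul_left (haarProbability G) g
    · simp only [hp, if_false]
      exact MeasurePreserving.id _
  exact measurePreserving_pi (fun _ => haarProbability G) (fun _ => haarProbability G) hf

/-- **(D) Invariance of the un-normalised functional** under the dangling-link symmetry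
(`M = 0`). -/
theorem integral_comp_mulDir (r : LatticeRep G) (g : G) (L : ℕ) [NeZero L] (β : ℝ)
    {F : Cfg G L 0 → ℝ} (hF : Measurable F) :
    ∫ U, F (mulDir g L 0 U) * wgt G r L 0 β U ∂(haarPi G L 0) =
      ∫ U, F U * wgt G r L 0 β U ∂(haarPi G L 0) := by
  have hmp := measurePreserving_mulDir (G := G) g L 0
  have h2 : ∫ V, F V * wgt G r L 0 β V ∂(Measure.map (mulDir g L 0) (haarPi G L 0)) =
      ∫ U, F (mulDir g L 0 U) * wgt G r L 0 β (mulDir g L 0 U) ∂(haarPi G L 0) :=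
    integral_map hmp.measurable.aemeasurable
      (by rw [hmp.map_eq]; exact (hF.mul (measurable_wgt r L 0 β)).aestronglyMeasurable)
  rw [hmp.map_eq] at h2
  calc ∫ U, F (mulDir g L 0 U) * wgt G r L 0 β U ∂(haarPi G L 0)
      = ∫ U, F (mulDir g L 0 U) * wgt G r L 0 β (mulDir g L 0 U) ∂(haarPi G L 0) := by
        simp only [wgt_mulDir]
    _ = ∫ V, F V * wgt G r L 0 β V ∂(haarPi G L 0) := h2.symm

end Core

/-! ## (D) The one-link observable of a dangling link -/

section ObsBasic

variable {G : Type}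

/-- The indicator of `{U (x₀, 2) ∈ O}`: an observable of ONE direction-`2` link. At `M = 0`
that link is dangling (in no plaquette), so its law under the tube measure is exactly Haar. -/
def obs (O : Set G) {L : ℕ} (x₀ : St L 0) : Cfg G L 0 → ℝ := fun U =>
  O.indicator (fun _ => (1 : ℝ)) (U (x₀, 2))

theorem obs_of_mem {O : Set G} {L : ℕ} {x₀ : St L 0} {U : Cfg G L 0} (h : U (x₀, 2) ∈ O) :
    obs O x₀ U = 1 := by
  simp [obs, h]

theorem obs_of_not_mem {O : Set G} {L : ℕ} {x₀ : St L 0} {U : Cfg G L 0} (h : U (x₀, 2) ∉ O) :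
    obs O x₀ U = 0 := by
  simp [obs, h]

theorem obs_congr (O : Set G) {L : ℕ} (x₀ : St L 0) {U U' : Cfg G L 0}
    (h : U (x₀, 2) = U' (x₀, 2)) : obs O x₀ U = obs O x₀ U' := by
  simp only [obs, h]

theorem obs_nonneg (O : Set G) {L : ℕ} (x₀ : St L 0) (U : Cfg G L 0) : 0 ≤ obs O x₀ U := by
  by_cases h : U (x₀, 2) ∈ O
  · rw [obs_of_mem h]; norm_num
  · rw [obs_of_not_mem h]

theorem obs_le_one (O : Set G) {L : ℕ} (x₀ : St L 0) (U : Cfg G L 0) : obs O x₀ U ≤ 1 := by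
  by_cases h : U (x₀, 2) ∈ O
  · rw [obs_of_mem h]
  · rw [obs_of_not_mem h]; norm_num

theorem abs_obs_le (O : Set G) {L : ℕ} (x₀ : St L 0) (U : Cfg G L 0) : |obs O x₀ U| ≤ 1 := by
  rw [abs_le]
  exact ⟨by linarith [obs_nonneg O x₀ U], obs_le_one O x₀ U⟩

theorem obs_mul_self (O : Set G) {L : ℕ} (x₀ : St L 0) (U : Cfg G L 0) :
    obs O x₀ U * obs O x₀ U = obs O x₀ U := by
  by_cases h : U (x₀, 2) ∈ O
  · rw [obs_of_mem h]; norm_num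
  · rw [obs_of_not_mem h]; norm_num

theorem measurable_obs [MeasurableSpace G] {O : Set G} (hO : MeasurableSet O) {L : ℕ}
    (x₀ : St L 0) : Measurable (obs O x₀ : Cfg G L 0 → ℝ) :=
  (measurable_const.indicator hO).comp (measurable_pi_apply (x₀, (2 : Fin 4)))

/-- The dangling-link symmetry translates the one-link observable. -/
theorem obs_mulDir [Group G] (O : Set G) (g : G) {L : ℕ} (x₀ : St L 0) (U : Cfg G L 0) :
    obs O x₀ (mulDir g L 0 U) = obs ((g * ·) ⁻¹' O) x₀ U := by
  by_cases h : g * U (x₀, 2) ∈ O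
  · rw [obs_of_mem (Set.mem_preimage.mpr h), obs_of_mem]
    rwa [mulDir_apply_two]
  · rw [obs_of_not_mem (fun h' => h (Set.mem_preimage.mp h')), obs_of_not_mem]
    rwa [mulDir_apply_two]

/-- The time shift by `n` moves the one-link indicator from time `c` to time `c + n`. -/
theorem obs_shiftT (O : Set G) {L : ℕ} (c : ZMod L) (n : ℕ) (U : Cfg G L 0) :
    obs O ((c, 0, 0, 0) : St L 0) (shiftT G L 0 n U) = obs O ((c + n, 0, 0, 0) : St L 0) U :=
  rfl

end ObsBasic

section OneLink

variable {G : Type} [Group G] [TopologicalSpace G] [IsTopologicalGroup G] [CompactSpace G]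
  [MeasurableSpace G] [BorelSpace G]

/-- **(D) The law of a dangling link is translation invariant** (un-normalised form). -/
theorem J_obs_translate (r : LatticeRep G) (β : ℝ) {O : Set G} (hO : MeasurableSet O) (g : G)
    {L : ℕ} [NeZero L] (x₀ : St L 0) :
    ∫ U, obs ((g * ·) ⁻¹' O) x₀ U * wgt G r L 0 β U ∂(haarPi G L 0) =
      ∫ U, obs O x₀ U * wgt G r L 0 β U ∂(haarPi G L 0) := by
  have h := integral_comp_mulDir r g L β (measurable_obs hO x₀)
  simpa only [obs_mulDir] using h

/-- **Upper bound**: if `O` is disjoint from its translate `a⁻¹ O`, the dangling link is in `O`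
with probability at most `1/2`. -/
theorem two_J_le_Z (r : LatticeRep G) (β : ℝ) {O : Set G} (hO : MeasurableSet O) {a : G}
    (haO : ∀ x ∈ O, a * x ∉ O) {L : ℕ} [NeZero L] (x₀ : St L 0) :
    2 * ∫ U, obs O x₀ U * wgt G r L 0 β U ∂(haarPi G L 0) ≤
      ∫ U, wgt G r L 0 β U ∂(haarPi G L 0) := by
  have hOa : MeasurableSet ((a * ·) ⁻¹' O) := measurable_const_mul a hO
  have hpt : ∀ U : Cfg G L 0, obs O x₀ U + obs ((a * ·) ⁻¹' O) x₀ U ≤ 1 := by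
    intro U
    by_cases h1 : U (x₀, 2) ∈ O
    · rw [obs_of_mem h1, obs_of_not_mem (fun h => haO _ h1 (Set.mem_preimage.mp h))]
      norm_num
    · rw [obs_of_not_mem h1, zero_add]
      exact obs_le_one _ x₀ U
  have hi₁ := integrable_mul_wgt r L 0 β (measurable_obs hO x₀) (abs_obs_le O x₀)
  have hi₂ := integrable_mul_wgt r L 0 β (measurable_obs hOa x₀) (abs_obs_le _ x₀)
  calc 2 * ∫ U, obs O x₀ U * wgt G r L 0 β U ∂(haarPi G L 0)
      = (∫ U, obs O x₀ U * wgt G r L 0 β U ∂(haarPi G L 0)) +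
          ∫ U, obs ((a * ·) ⁻¹' O) x₀ U * wgt G r L 0 β U ∂(haarPi G L 0) := by
        rw [two_mul, J_obs_translate r β hO a x₀]
    _ = ∫ U, (obs O x₀ U * wgt G r L 0 β U + obs ((a * ·) ⁻¹' O) x₀ U * wgt G r L 0 β U)
          ∂(haarPi G L 0) := (integral_add hi₁ hi₂).symm
    _ ≤ ∫ U, wgt G r L 0 β U ∂(haarPi G L 0) := by
        refine integral_mono (hi₁.add hi₂) (integrable_wgt r L 0 β) fun U => ?_
        have hw := (wgt_pos r L 0 β U).le
        calc obs O x₀ U * wgt G r L 0 β U + obs ((a * ·) ⁻¹' O) x₀ U * wgt G r L 0 β U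
            = (obs O x₀ U + obs ((a * ·) ⁻¹' O) x₀ U) * wgt G r L 0 β U := (add_mul _ _ _).symm
          _ ≤ 1 * wgt G r L 0 β U := mul_le_mul_of_nonneg_right (hpt U) hw
          _ = wgt G r L 0 β U := one_mul _

/-- **Lower bound**: if finitely many translates of `O` cover `G`, the dangling link is in `O`
with probability at least `1 / #translates`. -/
theorem Z_le_card_mul_J (r : LatticeRep G) (β : ℝ) {O : Set G} (hO : MeasurableSet O)
    (t : Finset G) (ht : ∀ x : G, ∃ g ∈ t, g * x ∈ O) {L : ℕ} [NeZero L] (x₀ : St L 0) :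
    ∫ U, wgt G r L 0 β U ∂(haarPi G L 0) ≤
      t.card * ∫ U, obs O x₀ U * wgt G r L 0 β U ∂(haarPi G L 0) := by
  have hOg : ∀ g : G, MeasurableSet ((g * ·) ⁻¹' O) := fun g => measurable_const_mul g hO
  have hpt : ∀ U : Cfg G L 0, (1 : ℝ) ≤ ∑ g ∈ t, obs ((g * ·) ⁻¹' O) x₀ U := by
    intro U
    obtain ⟨g, hg, hgx⟩ := ht (U (x₀, 2))
    have h1 : obs ((g * ·) ⁻¹' O) x₀ U = 1 := obs_of_mem (Set.mem_preimage.mpr hgx)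
    calc (1 : ℝ) = obs ((g * ·) ⁻¹' O) x₀ U := h1.symm
      _ ≤ ∑ g' ∈ t, obs ((g' * ·) ⁻¹' O) x₀ U :=
          Finset.single_le_sum (f := fun g' => obs ((g' * ·) ⁻¹' O) x₀ U)
            (fun g' _ => obs_nonneg _ x₀ U) hg
  have hi : ∀ g ∈ t, Integrable (fun U => obs ((g * ·) ⁻¹' O) x₀ U * wgt G r L 0 β U)
      (haarPi G L 0) := fun g _ => integrable_mul_wgt r L 0 β (measurable_obs (hOg g) x₀)
        (abs_obs_le _ x₀)
  calc ∫ U, wgt G r L 0 β U ∂(haarPi G L 0)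
      ≤ ∫ U, ∑ g ∈ t, obs ((g * ·) ⁻¹' O) x₀ U * wgt G r L 0 β U ∂(haarPi G L 0) := by
        refine integral_mono (integrable_wgt r L 0 β) (integrable_finsetSum t hi) fun U => ?_
        have hw := (wgt_pos r L 0 β U).le
        calc wgt G r L 0 β U = 1 * wgt G r L 0 β U := (one_mul _).symm
          _ ≤ (∑ g ∈ t, obs ((g * ·) ⁻¹' O) x₀ U) * wgt G r L 0 β U :=
              mul_le_mul_of_nonneg_right (hpt U) hw
          _ = ∑ g ∈ t, obs ((g * ·) ⁻¹' O) x₀ U * wgt G r L 0 β U := Finset.sum_mul _ _ _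
    _ = ∑ g ∈ t, ∫ U, obs ((g * ·) ⁻¹' O) x₀ U * wgt G r L 0 β U ∂(haarPi G L 0) :=
        integral_finsetSum t hi
    _ = ∑ g ∈ t, ∫ U, obs O x₀ U * wgt G r L 0 β U ∂(haarPi G L 0) :=
        Finset.sum_congr rfl fun g _ => J_obs_translate r β hO g x₀
    _ = t.card * ∫ U, obs O x₀ U * wgt G r L 0 β U ∂(haarPi G L 0) := by
        rw [Finset.sum_const, nsmul_eq_mul]

/-- **(D) The expectation of the dangling-link indicator is pinned in `[1/k, 1/2]`**, uniformly
in `L`, `β` and the position of the link. -/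
theorem Ex_obs_mem (r : LatticeRep G) (β : ℝ) {O : Set G} (hO : MeasurableSet O) {a : G}
    (haO : ∀ x ∈ O, a * x ∉ O) (t : Finset G) (ht : ∀ x : G, ∃ g ∈ t, g * x ∈ O)
    {L : ℕ} [NeZero L] (x₀ : St L 0) :
    1 / (t.card : ℝ) ≤ Ex G r L 0 β (obs O x₀) ∧ Ex G r L 0 β (obs O x₀) ≤ 1 / 2 := by
  have hZ := Z_pos r L 0 β (G := G)
  have hup := two_J_le_Z r β hO haO x₀
  have hlo := Z_le_card_mul_J r β hO t ht x₀
  have hk : (0 : ℝ) < t.card := by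
    have : t.Nonempty := by
      obtain ⟨g, hg, -⟩ := ht 1
      exact ⟨g, hg⟩
    exact_mod_cast this.card_pos
  rw [Ex_eq]
  constructor
  · rw [div_le_div_iff₀ hk hZ, one_mul, mul_comm]
    exact hlo
  · rw [div_le_div_iff₀ hZ two_pos, one_mul, mul_comm]
    exact hup

/-- **The variance floor.** `Ex(obs) − Ex(obs)² ≥ 1/(2k)`. -/
theorem variance_floor (r : LatticeRep G) (β : ℝ) {O : Set G} (hO : MeasurableSet O) {a : G}
    (haO : ∀ x ∈ O, a * x ∉ O) (t : Finset G) (ht : ∀ x : G, ∃ g ∈ t, g * x ∈ O)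
    {L : ℕ} [NeZero L] (x₀ : St L 0) :
    1 / (2 * (t.card : ℝ)) ≤
      Ex G r L 0 β (obs O x₀) - Ex G r L 0 β (obs O x₀) * Ex G r L 0 β (obs O x₀) := by
  obtain ⟨hPlo, hPhi⟩ := Ex_obs_mem r β hO haO t ht x₀
  set P := Ex G r L 0 β (obs O x₀)
  have h1 : 1 / (t.card : ℝ) * (1 / 2) ≤ P * (1 - P) :=
    mul_le_mul hPlo (by linarith) (by norm_num) (le_trans (by positivity) hPlo)
  calc 1 / (2 * (t.card : ℝ)) = 1 / (t.card : ℝ) * (1 / 2) := by ring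
    _ ≤ P * (1 - P) := h1
    _ = P - P * P := by ring

omit [IsTopologicalGroup G] [CompactSpace G] [MeasurableSpace G] [BorelSpace G] in
/-- In a Hausdorff topological group with an element `a ≠ 1` there is an open neighbourhood of
`1` disjoint from its `a`-translate. -/
theorem exists_open_translate_disjoint [T2Space G] [ContinuousMul G] {a : G} (ha : a ≠ 1) :
    ∃ O : Set G, IsOpen O ∧ (1 : G) ∈ O ∧ ∀ x ∈ O, a * x ∉ O := by
  obtain ⟨V, V', hV, hV', h1, ha', hdisj⟩ := t2_separation (Ne.symm ha)
  refine ⟨V ∩ (a * ·) ⁻¹' V', hV.inter (hV'.preimage (continuous_const_mul a)), ⟨h1, ?_⟩, ?_⟩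
  · simpa using ha'
  · rintro x ⟨-, hx⟩ ⟨hax, -⟩
    exact Set.disjoint_left.mp hdisj hax hx

/-- **(D) packaged**: for a group with a faithful representation and an element `a ≠ 1` there are
an open `O` and a number `k ≥ 1` such that on EVERY `M = 0` tube, at every `β` and position, the
dangling-link indicator `obs O x₀` has `Ex(obs) − Ex(obs)² ≥ 1/(2k)`. -/
theorem exists_variance_floor (r : LatticeRep G) {a : G} (ha : a ≠ 1) :
    ∃ O : Set G, IsOpen O ∧ ∃ k : ℝ, 0 < k ∧ ∀ (β : ℝ) (L : ℕ) [NeZero L] (x₀ : St L 0),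
      1 / (2 * k) ≤
        Ex G r L 0 β (obs O x₀) - Ex G r L 0 β (obs O x₀) * Ex G r L 0 β (obs O x₀) := by
  haveI := t2Space_of_rep r
  obtain ⟨O, hO, h1O, haO⟩ := exists_open_translate_disjoint ha
  obtain ⟨t, ht⟩ := compact_covered_by_mul_left_translates (G := G) (V := O) isCompact_univ
    (by rw [hO.interior_eq]; exact ⟨1, h1O⟩)
  have ht' : ∀ x : G, ∃ g ∈ t, g * x ∈ O := fun x => by
    simpa only [Set.mem_iUnion, Set.mem_preimage, exists_prop] using ht (Set.mem_univ x)
  have hk : (0 : ℝ) < t.card := by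
    have : t.Nonempty := by
      obtain ⟨g, hg, -⟩ := ht' 1
      exact ⟨g, hg⟩
    exact_mod_cast this.card_pos
  exact ⟨O, hO, t.card, hk, fun β L _ x₀ => variance_floor r β hO.measurableSet haO t ht' x₀⟩

omit [IsTopologicalGroup G] [CompactSpace G] [MeasurableSpace G] [BorelSpace G] in
/-- Exponential decay beats any constant. -/
theorem exists_forall_lt_of_pos (C m₀ v : ℝ) (hm₀ : 0 < m₀) (hv : 0 < v) :
    ∃ n₀ : ℕ, ∀ n : ℕ, n₀ ≤ n → C * Real.exp (-(m₀ * n)) < v := by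
  have h : Filter.Tendsto (fun n : ℕ => C * Real.exp (-(m₀ * n))) Filter.atTop
      (nhds (C * 0)) := by
    refine tendsto_const_nhds.mul (Real.tendsto_exp_atBot.comp ?_)
    exact Filter.tendsto_neg_atTop_atBot.comp
      (tendsto_natCast_atTop_atTop.const_mul_atTop hm₀)
  rw [mul_zero] at h
  exact (h.eventually (eventually_lt_nhds hv)).exists_forall_of_atTop

omit [Group G] [TopologicalSpace G] [IsTopologicalGroup G] [CompactSpace G] [BorelSpace G] in
/-- Slab locality of a one-link indicator: the link at time `c + j`, `j ≤ w`. -/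
theorem loc_obs {O : Set G} (hO : MeasurableSet O) {L : ℕ} [NeZero L] (w : ℕ) (c : ZMod L)
    (j : ℕ) (hj : j ≤ w) : Loc G L 0 w c (obs O ((c + j, 0, 0, 0) : St L 0)) := by
  refine ⟨measurable_obs hO _, abs_obs_le O _, fun U U' hUU' => obs_congr O _ (hUU' _ ?_)⟩
  show ((c + (j : ZMod L)) - c).val ≤ w
  rw [add_sub_cancel_left, ZMod.val_natCast]
  exact le_trans (Nat.mod_le j L) hj

end OneLink

/-! ## (A) Load-bearing analysis — negative lemmas -/

section LoadBearing

variable {G : Type} [Group G] [TopologicalSpace G] [IsTopologicalGroup G] [CompactSpace G]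
  [MeasurableSpace G] [BorelSpace G]

/-- **(A1) Load-bearing clause `2 * n < L` (time separations up to HALF the period).** With the
guard weakened to `n < L`, the clustering clause of the crux fails at `M = 0`, every `β`, every
rate `m₀ > 0`, every constant `C` and every volume floor — for EVERY compact group carrying a
faithful representation and an element `a ≠ 1`: the shift by `n = L − 1` wraps the time circle,
`F₂ ∘ σ_{L-1} = F₁` for the indicators `F₁ = 1{U((c,·),2) ∈ O}`, `F₂ = 1{U((c+1,·),2) ∈ O}` of a
dangling direction-2 link, whose covariance is the Haar variance `P(1-P) ≥ 1/(2k)` uniformly in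
`L`, while `C e^{-m₀ (L-1)} → 0`. ("Any proof must use `2n < L`", and it does: the trace
formula needs the long way round the circle to be longer than the short way.) -/
theorem tubeWith_fullCircle_false (r : LatticeRep G) {a : G} (ha : a ≠ 1) (β m₀ C : ℝ)
    (hm₀ : 0 < m₀) (w Lmin : ℕ) (hw : 1 ≤ w) :
    ¬ TubeWith G (fun n L => n < L) r 0 β m₀ C w Lmin := by
  intro hT
  obtain ⟨O, hO, k, hk, hvar⟩ := exists_variance_floor r ha
  obtain ⟨n₀, hn₀⟩ := exists_forall_lt_of_pos C m₀ (1 / (2 * k)) hm₀ (by positivity)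
  -- the period
  obtain ⟨L, hLmin, hL2, hLn⟩ : ∃ L : ℕ, Lmin ≤ L ∧ 2 ≤ L ∧ n₀ ≤ L - 1 :=
    ⟨max (max Lmin 2) (n₀ + 1), le_trans (le_max_left _ _) (le_max_left _ _),
      le_trans (le_max_right _ _) (le_max_left _ _), by omega⟩
  haveI : NeZero L := ⟨by omega⟩
  -- indicators of the dangling links at times `0` and `1`, slab `[0, w]`
  have hloc₀ := loc_obs (G := G) hO.measurableSet w (0 : ZMod L) 0 (Nat.zero_le w)
  have hloc₁ := loc_obs (G := G) hO.measurableSet w (0 : ZMod L) 1 hw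
  have key := hT L hLmin (0 : ZMod L) _ _ hloc₀ hloc₁ (L - 1) (show L - 1 < L by omega)
  -- the full-circle shift brings time `1` back to time `0`
  have hcast : ((0 : ZMod L) + ((1 : ℕ) : ZMod L) + ((L - 1 : ℕ) : ZMod L)) = (0 : ZMod L) + ((0 : ℕ) : ZMod L) := by
    rw [Nat.cast_sub (by omega : 1 ≤ L), ZMod.natCast_self, Nat.cast_one, Nat.cast_zero]
    ring
  simp only [obs_shiftT, hcast, obs_mul_self] at key
  have hv := hvar β L ((0 : ZMod L) + ((0 : ℕ) : ZMod L), 0, 0, 0)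
  have hlt := hn₀ (L - 1) hLn
  exact absurd (lt_of_le_of_lt (le_trans (le_trans hv (le_abs_self _)) key) hlt) (lt_irrefl _)

/-- **(A2) Load-bearing order of quantifiers `∀ w ∃ C`.** If ONE constant `C` had to serve every
slab width `w` (the floor `Lmin` may still depend on `w`), the clause fails at `M = 0` for every
`(G, r)` as above, every `β`, `m₀ > 0`: take `n = w`, `F₁` the indicator of the dangling link at
time `c + w`, `F₂` the one at time `c`; then `F₂ ∘ σ_w = F₁` (overlapping slabs), covariance
`≥ 1/(2k)`, against `C e^{-m₀ w} → 0` as `w → ∞`. (So `C = C(w)`, of size `e^{m₀ (w+1)}`, is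
forced; the line's S2a constant `64·e^{m₀(w+1)}` has the right shape.) -/
theorem tubeWith_uniformW_false (r : LatticeRep G) {a : G} (ha : a ≠ 1) (β m₀ C : ℝ)
    (hm₀ : 0 < m₀) (Lmin : ℕ → ℕ) :
    ¬ ∀ w : ℕ, TubeWith G (fun n L => 2 * n < L) r 0 β m₀ C w (Lmin w) := by
  intro hT
  obtain ⟨O, hO, k, hk, hvar⟩ := exists_variance_floor r ha
  obtain ⟨n₀, hn₀⟩ := exists_forall_lt_of_pos C m₀ (1 / (2 * k)) hm₀ (by positivity)
  -- slab width `w = n₀`, separation `n = n₀`, period `L > 2 n₀`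
  obtain ⟨L, hLmin, hL⟩ : ∃ L : ℕ, Lmin n₀ ≤ L ∧ 2 * n₀ < L :=
    ⟨max (Lmin n₀) (2 * n₀ + 1), le_max_left _ _, by omega⟩
  haveI : NeZero L := ⟨by omega⟩
  have hloc₀ := loc_obs (G := G) hO.measurableSet n₀ (0 : ZMod L) 0 (Nat.zero_le _)
  have hloc₁ := loc_obs (G := G) hO.measurableSet n₀ (0 : ZMod L) n₀ le_rfl
  have key := hT n₀ L hLmin (0 : ZMod L) _ _ hloc₁ hloc₀ n₀ (show 2 * n₀ < L from hL)
  have hcast : ((0 : ZMod L) + ((0 : ℕ) : ZMod L) + (n₀ : ZMod L)) = (0 : ZMod L) + (n₀ : ZMod L) := by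
    rw [Nat.cast_zero, add_zero]
  simp only [obs_shiftT, hcast, obs_mul_self] at key
  have hv := hvar β L ((0 : ZMod L) + (n₀ : ZMod L), 0, 0, 0)
  have hlt := hn₀ n₀ le_rfl
  exact absurd (lt_of_le_of_lt (le_trans (le_trans hv (le_abs_self _)) key) hlt) (lt_irrefl _)

/-- **(A3) Load-bearing bound `|F U| ≤ 1`.** With unbounded observables (and a constant `C` not
depending on them) the clause fails at `M = 0` for every `(G, r)` as above, every `β`, `m₀`, `C`,
`Lmin`, already at separation `n = 1` and slab width `1`: scale the dangling-link indicators by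
`s`; the covariance scales by `s²`. (Equivalently: `C` must be allowed to carry `‖F₁‖∞ ‖F₂‖∞`.) -/
theorem tubeU_false (r : LatticeRep G) {a : G} (ha : a ≠ 1) (β m₀ C : ℝ) (Lmin : ℕ) :
    ¬ TubeU G r 0 β m₀ C 1 Lmin := by
  intro hT
  obtain ⟨O, hO, k, hk, hvar⟩ := exists_variance_floor r ha
  obtain ⟨L, hLmin, hL⟩ : ∃ L : ℕ, Lmin ≤ L ∧ 3 ≤ L := ⟨max Lmin 3, le_max_left _ _, le_max_right _ _⟩
  haveI : NeZero L := ⟨by omega⟩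
  -- the scale
  set v : ℝ := 1 / (2 * k) with hv_def
  have hv : 0 < v := by positivity
  set E : ℝ := Real.exp (-(m₀ * ((1 : ℕ) : ℝ))) with hE_def
  have hE0 : 0 < E := Real.exp_pos _
  set B : ℝ := |C| * E + 1 with hB_def
  set s : ℝ := max 1 (B / v) with hs_def
  have hs1 : 1 ≤ s := le_max_left _ _
  have hs0 : 0 ≤ s := le_trans zero_le_one hs1
  have hsv : B ≤ s * s * v := by
    have h1 : B / v ≤ s := le_max_right _ _
    have h2 : B ≤ s * v := by rwa [div_le_iff₀ hv] at h1
    calc B ≤ s * v := h2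
      _ = 1 * (s * v) := (one_mul _).symm
      _ ≤ s * (s * v) := mul_le_mul_of_nonneg_right hs1 (le_trans (by positivity) h2)
      _ = s * s * v := by ring
  -- scaled indicators at times `0` and `1`
  obtain ⟨hm₀', -, hl₀⟩ := loc_obs (G := G) hO.measurableSet 1 (0 : ZMod L) 0 (Nat.zero_le _)
  obtain ⟨hm₁', -, hl₁⟩ := loc_obs (G := G) hO.measurableSet 1 (0 : ZMod L) 1 le_rfl
  set x₀ : St L 0 := ((0 : ZMod L) + ((0 : ℕ) : ZMod L), 0, 0, 0) with hx₀
  set x₁ : St L 0 := ((0 : ZMod L) + ((1 : ℕ) : ZMod L), 0, 0, 0) with hx₁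
  have hlocU₀ : LocU G L 0 1 (0 : ZMod L) (fun U => s * obs O x₀ U) :=
    ⟨measurable_const.mul hm₀', fun U U' h => by simp only [hl₀ U U' h]⟩
  have hlocU₁ : LocU G L 0 1 (0 : ZMod L) (fun U => s * obs O x₁ U) :=
    ⟨measurable_const.mul hm₁', fun U U' h => by simp only [hl₁ U U' h]⟩
  have key := hT L hLmin (0 : ZMod L) _ _ hlocU₁ hlocU₀ 1 (show 2 * 1 < L by omega)
  have hshift : ∀ U : Cfg G L 0, obs O x₀ (shiftT G L 0 1 U) = obs O x₁ U := by
    intro U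
    rw [hx₀, hx₁, obs_shiftT, Nat.cast_zero, add_zero]
  -- reduce the three expectations to `P = Ex(obs O x₁)`
  have e1 : (fun U : Cfg G L 0 => s * obs O x₁ U * (s * obs O x₀ (shiftT G L 0 1 U))) =
      fun U => (s * s) * obs O x₁ U := by
    funext U
    rw [hshift, mul_mul_mul_comm, obs_mul_self]
  have e2 : (fun U : Cfg G L 0 => s * obs O x₀ (shiftT G L 0 1 U)) = fun U => s * obs O x₁ U := by
    funext U
    rw [hshift]
  rw [e1, e2, Ex_const_mul, Ex_const_mul] at key
  have hv' := hvar β L x₁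
  set P := Ex G r L 0 β (obs O x₁)
  have hkey : s * s * (P - P * P) ≤ C * E := by
    have : s * s * P - s * P * (s * P) = s * s * (P - P * P) := by ring
    rw [this] at key
    exact le_trans (le_abs_self _) key
  have hC : C * E < B := by
    have : C * E ≤ |C| * E := mul_le_mul_of_nonneg_right (le_abs_self C) hE0.le
    rw [hB_def]
    linarith
  have hmid : s * s * v ≤ s * s * (P - P * P) := mul_le_mul_of_nonneg_left hv' (mul_nonneg hs0 hs0)
  linarith

end LoadBearing

/-! ## The variants, verbatim (one token changed each), and their bridges -/

/-- **Variant (A1)**: the crux `FibreAnchor` VERBATIM except that the guard `2 * n < L` is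
weakened to `n < L` (all time separations on the circle). FALSE: `not_fibreAnchorFullCircle`. -/
def FibreAnchorFullCircle : Prop :=
  ∀ (G : Type) [Group G] [TopologicalSpace G] [IsTopologicalGroup G] [CompactSpace G], Literature.MathematicalPhysics.QuantumFieldTheory.IsCompactSimpleLieGroup G → letI : MeasurableSpace G := borel G; haveI : BorelSpace G := ⟨rfl⟩; ∀ r : Literature.MathematicalPhysics.QuantumFieldTheory.LatticeRep G, let Tube := fun (M : ℕ) (β m C : ℝ) (w Lmin : ℕ) => ∀ (L : ℕ) [NeZero L], Lmin ≤ L → let St := ZMod L × ZMod L × Fin (M + 1) × Fin (M + 1); let Cfg := St × Fin 4 → G; let ν : MeasureTheory.Measure Cfg := MeasureTheory.Measure.pi fun _ => Literature.MathematicalPhysics.QuantumFieldTheory.haarProbability G; let sh : St → Fin 4 → St := fun x μ => ![(x.1 + 1, x.2.1, x.2.2.1, x.2.2.2), (x.1, x.2.1 + 1, x.2.2.1, x.2.2.2), (x.1, x.2.1, x.2.2.1 + 1, x.2.2.2), (x.1, x.2.1, x.2.2.1, x.2.2.2 + 1)] μ; let ins : St → Fin 4 → Fin 4 → ℝ :=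 fun x μ κ => if ((μ = 2 ∨ κ = 2) → (x.2.2.1 : ℕ) < M) ∧ ((μ = 3 ∨ κ = 3) → (x.2.2.2 : ℕ) < M) then 1 else 0; let pl : Cfg → St → Fin 4 → Fin 4 → G := fun U x μ κ => U (x, μ) * U (sh x μ, κ) * (U (sh x κ, μ))⁻¹ * (U (x, κ))⁻¹; let act : Cfg → ℝ := fun U => β * ∑ x : St, ∑ q : {q : Fin 4 × Fin 4 // q.1 < q.2}, ins x q.1.1 q.1.2 * (r.ρ (pl U x q.1.1 q.1.2)).trace.re; let wgt : Cfg → ℝ := fun U => Real.exp (act U); let Ex : (Cfg → ℝ) → ℝ := fun F => (∫ U, F U * wgt U ∂ν) / (∫ U, wgt U ∂ν); let σ : ℕ → Cfg → Cfg := fun n U p => U ((p.1.1 + n, p.1.2), p.2); ∀ c : ZMod L, let Loc := fun F : Cfg → ℝ => Measurable F ∧ (∀ U, |F U| ≤ 1) ∧ ∀ U U', (∀ p : St × Fin 4, (p.1.1 - c).val ≤ w → U p = U' p) → F U = F U'; ∀ F₁ F₂ : Cfg → ℝ, Loc F₁ → Loc F₂ → ∀ n : ℕ, n < L → |Ex (fun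 U => F₁ U * F₂ (σ n U)) - Ex F₁ * Ex (fun U => F₂ (σ n U))| ≤ C * Real.exp (-(m * n)); ∀ M : ℕ, ∃ β₀ m₀ : ℝ, 0 < m₀ ∧ ∀ β : ℝ, β₀ ≤ β → ∀ w : ℕ, ∃ C : ℝ, ∃ Lmin : ℕ, Tube M β m₀ C w Lmin

/-- **Variant (A2)**: the crux VERBATIM except that the constant is chosen BEFORE the slab width,
`∃ C, ∀ w, ∃ Lmin` in place of `∀ w, ∃ C, ∃ Lmin`. FALSE: `not_fibreAnchorUniformW`. -/
def FibreAnchorUniformW : Prop :=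
  ∀ (G : Type) [Group G] [TopologicalSpace G] [IsTopologicalGroup G] [CompactSpace G], Literature.MathematicalPhysics.QuantumFieldTheory.IsCompactSimpleLieGroup G → letI : MeasurableSpace G := borel G; haveI : BorelSpace G := ⟨rfl⟩; ∀ r : Literature.MathematicalPhysics.QuantumFieldTheory.LatticeRep G, let Tube := fun (M : ℕ) (β m C : ℝ) (w Lmin : ℕ) => ∀ (L : ℕ) [NeZero L], Lmin ≤ L → let St := ZMod L × ZMod L × Fin (M + 1) × Fin (M + 1); let Cfg := St × Fin 4 → G; let ν : MeasureTheory.Measure Cfg := MeasureTheory.Measure.pi fun _ => Literature.MathematicalPhysics.QuantumFieldTheory.haarProbability G; let sh : St → Fin 4 → St := fun x μ => ![(x.1 + 1, x.2.1, x.2.2.1, x.2.2.2), (x.1, x.2.1 + 1, x.2.2.1, x.2.2.2), (x.1, x.2.1, x.2.2.1 + 1, x.2.2.2), (x.1, x.2.1, x.2.2.1, x.2.2.2 + 1)] μ; let ins : St → Fin 4 → Fin 4 → ℝ := fun x μ κ => if ((μ = 2 ∨ κ = 2) → (x.2.2.1 : ℕ) < M) ∧ ((μ = 3 ∨ κ =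 3) → (x.2.2.2 : ℕ) < M) then 1 else 0; let pl : Cfg → St → Fin 4 → Fin 4 → G := fun U x μ κ => U (x, μ) * U (sh x μ, κ) * (U (sh x κ, μ))⁻¹ * (U (x, κ))⁻¹; let act : Cfg → ℝ := fun U => β * ∑ x : St, ∑ q : {q : Fin 4 × Fin 4 // q.1 < q.2}, ins x q.1.1 q.1.2 * (r.ρ (pl U x q.1.1 q.1.2)).trace.re; let wgt : Cfg → ℝ := fun U => Real.exp (act U); let Ex : (Cfg → ℝ) → ℝ := fun F => (∫ U, F U * wgt U ∂ν) / (∫ U, wgt U ∂ν); let σ : ℕ → Cfg → Cfg := fun n U p => U ((p.1.1 + n, p.1.2), p.2); ∀ c : ZMod L, let Loc := fun F : Cfg → ℝ => Measurable F ∧ (∀ U, |F U| ≤ 1) ∧ ∀ U U', (∀ p : St × Fin 4, (p.1.1 - c).val ≤ w → U p = U' p) → F U = F U'; ∀ F₁ F₂ : Cfg → ℝ, Loc F₁ → Loc F₂ → ∀ n : ℕ, 2 * n < L → |Ex (fun U => F₁ U * F₂ (σ n U)) - Ex F₁ * Ex (fun U => F₂ (σ n U))| ≤ C * Real.exp (-(m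 * n)); ∀ M : ℕ, ∃ β₀ m₀ : ℝ, 0 < m₀ ∧ ∀ β : ℝ, β₀ ≤ β → ∃ C : ℝ, ∀ w : ℕ, ∃ Lmin : ℕ, Tube M β m₀ C w Lmin

/-- **Variant (A3)**: the crux VERBATIM except that the bound `(∀ U, |F U| ≤ 1)` is dropped from
`Loc` (the constant `C` still may not depend on the observables). FALSE:
`not_fibreAnchorUnbounded`. -/
def FibreAnchorUnbounded : Prop :=
  ∀ (G : Type) [Group G] [TopologicalSpace G] [IsTopologicalGroup G] [CompactSpace G], Literature.MathematicalPhysics.QuantumFieldTheory.IsCompactSimpleLieGroup G → letI : MeasurableSpace G := borel G; haveI : BorelSpace G := ⟨rfl⟩; ∀ r : Literature.MathematicalPhysics.QuantumFieldTheory.LatticeRep G, let Tube := fun (M : ℕ) (β m C : ℝ) (w Lmin : ℕ) => ∀ (L : ℕ) [NeZero L], Lmin ≤ L → let St := ZMod L × ZMod L × Fin (M + 1) × Fin (M + 1); let Cfg := St × Fin 4 → G; let ν : MeasureTheory.Measure Cfg := MeasureTheory.Measure.pi fun _ => Literature.MathematicalPhysics.QuantumFieldTheory.haarProbability G; let sh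 : St → Fin 4 → St := fun x μ => ![(x.1 + 1, x.2.1, x.2.2.1, x.2.2.2), (x.1, x.2.1 + 1, x.2.2.1, x.2.2.2), (x.1, x.2.1, x.2.2.1 + 1, x.2.2.2), (x.1, x.2.1, x.2.2.1, x.2.2.2 + 1)] μ; let ins : St → Fin 4 → Fin 4 → ℝ := fun x μ κ => if ((μ = 2 ∨ κ = 2) → (x.2.2.1 : ℕ) < M) ∧ ((μ = 3 ∨ κ = 3) → (x.2.2.2 : ℕ) < M) then 1 else 0; let pl : Cfg → St → Fin 4 → Fin 4 → G := fun U x μ κ => U (x, μ) * U (sh x μ, κ) * (U (sh x κ, μ))⁻¹ * (U (x, κ))⁻¹; let act : Cfg → ℝ := fun U => β * ∑ x : St, ∑ q : {q : Fin 4 × Fin 4 // q.1 < q.2}, ins x q.1.1 q.1.2 * (r.ρ (pl U x q.1.1 q.1.2)).trace.re; let wgt : Cfg → ℝ := fun U => Real.exp (act U); let Ex : (Cfg → ℝ) → ℝ := fun F => (∫ U, F U * wgt U ∂ν) / (∫ U, wgt U ∂ν); let σ : ℕ → Cfg → Cfg := fun n U p => U ((p.1.1 + n, p.1.2), p.2);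 ∀ c : ZMod L, let Loc := fun F : Cfg → ℝ => Measurable F ∧ ∀ U U', (∀ p : St × Fin 4, (p.1.1 - c).val ≤ w → U p = U' p) → F U = F U'; ∀ F₁ F₂ : Cfg → ℝ, Loc F₁ → Loc F₂ → ∀ n : ℕ, 2 * n < L → |Ex (fun U => F₁ U * F₂ (σ n U)) - Ex F₁ * Ex (fun U => F₂ (σ n U))| ≤ C * Real.exp (-(m * n)); ∀ M : ℕ, ∃ β₀ m₀ : ℝ, 0 < m₀ ∧ ∀ β : ℝ, β₀ ≤ β → ∀ w : ℕ, ∃ C : ℝ, ∃ Lmin : ℕ, Tube M β m₀ C w Lmin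

theorem fibreAnchorFullCircle_iff :
    FibreAnchorFullCircle ↔
      ∀ (G : Type) [Group G] [TopologicalSpace G] [IsTopologicalGroup G] [CompactSpace G],
        IsCompactSimpleLieGroup G → letI : MeasurableSpace G := borel G;
        haveI : BorelSpace G := ⟨rfl⟩;
        ∀ r : LatticeRep G, ∀ M : ℕ, ∃ β₀ m₀ : ℝ, 0 < m₀ ∧ ∀ β : ℝ, β₀ ≤ β → ∀ w : ℕ,
          ∃ C : ℝ, ∃ Lmin : ℕ, TubeWith G (fun n L => n < L) r M β m₀ C w Lmin :=
  Iff.rfl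

theorem fibreAnchorUniformW_iff :
    FibreAnchorUniformW ↔
      ∀ (G : Type) [Group G] [TopologicalSpace G] [IsTopologicalGroup G] [CompactSpace G],
        IsCompactSimpleLieGroup G → letI : MeasurableSpace G := borel G;
        haveI : BorelSpace G := ⟨rfl⟩;
        ∀ r : LatticeRep G, ∀ M : ℕ, ∃ β₀ m₀ : ℝ, 0 < m₀ ∧ ∀ β : ℝ, β₀ ≤ β → ∃ C : ℝ,
          ∀ w : ℕ, ∃ Lmin : ℕ, TubeWith G (fun n L => 2 * n < L) r M β m₀ C w Lmin :=
  Iff.rfl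

theorem fibreAnchorUnbounded_iff :
    FibreAnchorUnbounded ↔
      ∀ (G : Type) [Group G] [TopologicalSpace G] [IsTopologicalGroup G] [CompactSpace G],
        IsCompactSimpleLieGroup G → letI : MeasurableSpace G := borel G;
        haveI : BorelSpace G := ⟨rfl⟩;
        ∀ r : LatticeRep G, ∀ M : ℕ, ∃ β₀ m₀ : ℝ, 0 < m₀ ∧ ∀ β : ℝ, β₀ ≤ β → ∀ w : ℕ,
          ∃ C : ℝ, ∃ Lmin : ℕ, TubeU G r M β m₀ C w Lmin :=
  Iff.rfl

/-! ## Unconditional negations: `SU(2)` is a certified instance of the crux's hypotheses -/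

section SU2

open Literature.MathematicalPhysics.QuantumLattice

/-- The fundamental representation of `SU(2)` as lattice representation data. -/
def su2Rep : LatticeRep (Matrix.specialUnitaryGroup (Fin 2) ℂ) :=
  ⟨2, fundamentalRep (Fin 2), continuous_fundamentalRep _, fundamentalRep_injective _,
    fundamentalRep_mem_unitaryGroup⟩

/-- `SU(2)` is a compact simple Lie group in the crux's sense (tree:
`isSimpleCompactGroup_specialUnitaryGroup_holds`). -/
theorem isCompactSimpleLieGroup_su2 :
    IsCompactSimpleLieGroup (Matrix.specialUnitaryGroup (Fin 2) ℂ) :=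
  isCompactSimpleLieGroup_specialUnitaryGroup isSimpleCompactGroup_specialUnitaryGroup_holds
    le_rfl

/-- **(A1), unconditional.** -/
theorem not_fibreAnchorFullCircle : ¬ FibreAnchorFullCircle := by
  intro h
  obtain ⟨β₀, m₀, hm₀, h2⟩ := fibreAnchorFullCircle_iff.mp h (Matrix.specialUnitaryGroup (Fin 2) ℂ)
    isCompactSimpleLieGroup_su2 su2Rep 0
  obtain ⟨C, Lmin, hT⟩ := h2 β₀ le_rfl 1
  obtain ⟨a, ha⟩ := exists_ne_one_of_isCompactSimpleLieGroup isCompactSimpleLieGroup_su2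
  exact tubeWith_fullCircle_false su2Rep ha β₀ m₀ C hm₀ 1 Lmin le_rfl hT

/-- **(A2), unconditional.** -/
theorem not_fibreAnchorUniformW : ¬ FibreAnchorUniformW := by
  intro h
  obtain ⟨β₀, m₀, hm₀, h2⟩ := fibreAnchorUniformW_iff.mp h (Matrix.specialUnitaryGroup (Fin 2) ℂ)
    isCompactSimpleLieGroup_su2 su2Rep 0
  obtain ⟨C, hC⟩ := h2 β₀ le_rfl
  choose Lmin hLmin using hC
  obtain ⟨a, ha⟩ := exists_ne_one_of_isCompactSimpleLieGroup isCompactSimpleLieGroup_su2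
  exact tubeWith_uniformW_false su2Rep ha β₀ m₀ C hm₀ Lmin hLmin

/-- **(A3), unconditional.** -/
theorem not_fibreAnchorUnbounded : ¬ FibreAnchorUnbounded := by
  intro h
  obtain ⟨β₀, m₀, -, h2⟩ := fibreAnchorUnbounded_iff.mp h (Matrix.specialUnitaryGroup (Fin 2) ℂ)
    isCompactSimpleLieGroup_su2 su2Rep 0
  obtain ⟨C, Lmin, hT⟩ := h2 β₀ le_rfl 1
  obtain ⟨a, ha⟩ := exists_ne_one_of_isCompactSimpleLieGroup isCompactSimpleLieGroup_su2
  exact tubeU_false su2Rep ha β₀ m₀ C Lmin hT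

/-! ## Near-misses (documented obstructions; `sorry` permitted ONLY in this work file) -/

/-- **(A4) β-UNIFORM floor and constant — false by torelons, NOT yet formalised.** If `C` and
`Lmin` are chosen before `β` (`∀ w, ∃ C Lmin, ∀ β ≥ β₀`), the clause fails already at `M = 0`
(2-d `SU(2)` Yang–Mills on the `L × L` torus, `L` FIXED `≥ max Lmin (2n₀+2)` with
`C e^{−m₀ n₀} < 1/8`, and `β → ∞`). Witness: the spatial Polyakov loop
`P_t(U) = ½ Re tr ∏ₓ U((t,x),1)`, a `[t,t]`-slab observable bounded by `1`.
(i) CENTRE-SEAM SYMMETRY (exact, soft): multiplying the links `((t,0),1)`, all `t`, by `−1 ∈ Z(SU(2))`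
preserves every plaquette and product Haar, and flips every `P_t`; hence `E[P_t] = 0` and the
clause reads `E[P_0 P_n] ≤ C e^{−m₀ n}`.
(ii) NEAR-FLATNESS (soft, Laplace upper bound only): on a FIXED finite lattice the Gibbs measure
concentrates as `β → ∞` on flat configurations, where consecutive holonomies are conjugate, so
`E[(P_0 − P_n)²] → 0`; with reflection positivity even `E[P_0 P_n] ≥ E[P_0²](1 − δ(β))^n`,
`δ → 0`.
(iii) THE MISSING QUANTITATIVE INPUT: `liminf_{β→∞} E_{β,L}[P_0²] > C e^{−m₀ n₀}`, i.e. the law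
of the holonomy does NOT concentrate on the equator `{tr = 0}`. True value: by the character
expansion the Polyakov-loop law on the `L × L` torus is
`p_β(h) dh = Σ_j t_j(β)^{L²} |χ_j(h)|² dh / Σ_j t_j(β)^{L²}` (cylinder kernel glued along the
loop), `t_j = I_{2j+1}(2β)/I_1(2β)` the normalised character coefficients of `exp(β tr U)`, and
as `β → ∞` (`t_j^{L²} ≈ e^{−L² j(j+1)/β}`) this is the conjugation-averaged heat kernel on the
diagonal, `∝ dθ` UNIFORM in the torus angle (Weyl factor `sin²θ` cancelled by the
transversal Gaussian `1/sin²θ`) — so `E[P_0²] = E[cos²θ] → 1/2`, independent of `L`.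
Contradiction for `β` large. (Equivalently, in rates: torelon mass `σ₂(β)·L ≈ 3L/(4β) → 0`.)
Obstruction to a Lean proof: (iii) needs Peter–Weyl orthogonality of `SU(2)` characters and the
class-function convolution semigroup (the tree's `ContinuumLimitsYM2*` / `HeatKernelGroupGauge*`
files hold pieces, not the torus Polyakov-loop law), then a Laplace/heat-kernel asymptotic.
(i)–(ii) are formalisable now but give nothing without (iii): if the holonomy law DID concentrate
on the equator, every gauge-invariant slab observable would be asymptotically deterministic and
no slab pair could witness the failure. Information for the prover: the floor must grow at least
like `L_min(β) ≳ m₀ β` (`× (M+1)²` for general `M`), exactly the route's `L_min ≍ m₀/σ₂`; and the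
β-dependence of `C` is NOT what saves the crux here (the witness has `|P| ≤ 1`, covariance `≍ 1/2`). -/
theorem tubeWith_uniformFloor_false_su2 :
    ¬ ∃ β₀ m₀ : ℝ, 0 < m₀ ∧ ∀ w : ℕ, ∃ C : ℝ, ∃ Lmin : ℕ, ∀ β : ℝ, β₀ ≤ β →
        TubeWith (Matrix.specialUnitaryGroup (Fin 2) ℂ) (fun n L => 2 * n < L) su2Rep 0 β m₀ C
          w Lmin := by
  sorry

end SU2

end Summit.QuantumFields.YangMills.Cruxes.FibreAnchor.Disproof

end
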